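import Summits.NavierStokesRegularity.FunctionalMining.HsChessboardLow
import HarnessLib

/-!
# FunctionalMining — Gibbon's chessboard on `T³` at EVERY order `n`, squares `3 < m ≤ ∞`:
# `∫₀ᵀ ‖∇ⁿu‖_{2m}^{α_{n,m}} dt ≤ K(1+T)` and the row `m = ∞` in majorant form

Search for candidate a priori estimates; no regularity claim. Cell `pub-nsfunc`, lit seat (gen 16);
sequel of `HsChessboardLow` (squares `1 ≤ m ≤ 3`). With the Agmon inequality at every order
(`HsWordEnergy.sum_norm_sq_wordDeriv_le_agmon`: `|∇ⁿv(x)|² ≤ A_n(v) := (2/π²)√E_{n+1}(v)√E_{n+2}(v)`)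
and the Sobolev bound `∫|∇ⁿv|⁶ ≤ C E_{n+1}³`, the step "sup × `L⁶`" (here by Agmon × `L⁶`; cf. Gibbon's
Appendix A §5.1, where it is Gagliardo–Nirenberg with an auxiliary order `N`, arXiv eqs. (pr2)–(adef2))
gives the remaining squares for CLASSICAL zero-mean solutions of unforced Navier–Stokes
on `[0, T] × T³` with `‖u(0)‖₂² ≤ M`, at EVERY order `n ≥ 0`
(`|∇ⁿu(t,x)|² = ∑_{w : Fin n → Fin 3} ‖∂^w u(t,x)‖²`):

* `HsChessboard.integral_wordSq_rpow_le_high` — `∫|∇ⁿv|^{2m} ≤ C(2/π²)^{m−3} E_{n+1}^{(m+3)/2}E_{n+2}^{(m−3)/2}`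
  for `3 < m` (`|∇ⁿv|^{2m} ≤ A_n^{m−3}|∇ⁿv|⁶` pointwise);
* `HsChessboard.chessboard_high` — **squares `(n, m)`, `3 < m < ∞`, every `n ≥ 0`**:
  `∫₀ᵀ (∫|∇ⁿu|^{2m})^{1/(2m(n+1)−3)} dt ≤ K(1+T)` (Hölder in time with weights
  `(m+3)(2n+1)/(2D) + (m−3)(2n+3)/(2D) = 1`, `D = 2m(n+1)−3`, against FGT at `s = n+1, n+2`);
* `HsChessboard.wordSq_le_agmonMajorant`, `HsChessboard.chessboard_top` — **row `m = ∞`, every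
  `n ≥ 0`, majorant form** (`α_{n,∞} = 1/(n+1)`, `‖∇ⁿu‖_∞^{α} = (sup|∇ⁿu|²)^{1/(2(n+1))}`): the explicit
  majorant `A_n(u(t)) ≥ |∇ⁿu(t,x)|²` satisfies `∫₀ᵀ A_n(u(t))^{1/(2(n+1))} dt ≤ K(1+T)` (Hölder with
  weights `(2n+1)/(4(n+1)) + (2n+3)/(4(n+1)) = 1` against FGT at `s = n+1, n+2`) — the form in which the
  tree already holds the squares `(0, ∞)`, `(1, ∞)` (`Torus.classicalNS_integral_agmonMajorant_le`,
  `…gradientAgmonMajorant_le`).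

With `HsTimeAverages` (`m = 1`), `HsChessboardLow` (`1 < m ≤ 3`) and this file, EVERY square
`(n, m)`, `n ≥ 1`, `1 ≤ m ≤ ∞`, of Gibbon's Table 1 — and the row `n = 0` for `3 ≤ m ≤ ∞` — is an a
priori bound in the kernel for classical solutions on `T³`, in the printed shape `K(1+T)` with
`K = K(n, m, ν, ‖u₀‖)` existential (print: `c_{n,m}L⁻¹ν^{α}Re³ + O(T⁻¹)` for Leray–Hopf solutions of
the forced equations). Energy-class bounds; no regularity claim.

## Mathlib / tree search

Tree (used): `HsWordEnergy.sum_norm_sq_wordDeriv_le_agmon`, `….exists_integral_cube_sum_norm_sq_wordDeriv_le`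
(`HsWordEnergies`); `HsChessboard.time_holder`, `….continuousOn_integral_wordSq_rpow` (`HsChessboardLow`);
`HsTimeAverages.timeAverage_le`, `….continuousOn_hsEnergy`. Pattern of `TorusNSChessboardHigherSquares`
(`Torus.integral_gradSq_rpow_le_of_cube_le_high`, `Torus.exists_classicalNS_integral_gradSq_rpow_le_high`).

## References

* [Gibbon2019Chessboard] J. D. Gibbon, J. Nonlinear Sci. 29 (2019) 215–228, Thm 1 / Table 1,
  Thm 2 (i)–(ii) eq. (w1) (norm form; Thm 1 is the inverse-length-scale form, same ranges),
  Appendix A §5.1 (Gagliardo–Nirenberg step, arXiv eqs. (pr2)–(adef2)), §5.2 (held: arXiv:1803.11518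
  pp. 4–7).
* [FoiasGuillopeTemam1981] Comm. PDE 6 (1981) 329–359, Thm 3.1.
* [Ayala2014Thesis] App. A (A.3) (Agmon on `T³`).
-/

noncomputable section

open MeasureTheory Set Filter Topology Function Real intervalIntegral Finset UnitAddTorus
open scoped InnerProductSpace RealInnerProductSpace ENNReal BigOperators

namespace Summit.NavierStokesRegularity.FunctionalMining

open Literature.Analysis Literature.Analysis.FunctionSpaces Literature.Analysis.FluidPDE
open Literature.Analysis.FunctionSpaces.Torus Literature.Analysis.FluidPDE.Torus

namespace HsChessboard

/-! ## 1. Sup × `L⁶` at every order -/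

/-- **Sup × `L⁶` at every order, `3 < m`** (here by Agmon × `L⁶`; cf. Gibbon App. A §5.1, there by
Gagliardo–Nirenberg with an auxiliary order `N`): for a smooth zero-mean `v` on `T³` with the Sobolev
bound `∫|∇ⁿv|⁶ ≤ C E_{n+1}(v)³`,
`∫ |∇ⁿv|^{2m} ≤ C (2/π²)^{m−3} E_{n+1}(v)^{(m+3)/2} E_{n+2}(v)^{(m−3)/2}`, `|∇ⁿv|² = ∑_w ‖∂^w v‖²`
(pointwise `|∇ⁿv|² ≤ (2/π²)√E_{n+1}√E_{n+2}`, `HsWordEnergy.sum_norm_sq_wordDeriv_le_agmon`).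
[cite: Gibbon2019Chessboard, Appendix A §5.1 (cf. eqs. (pr2)–(adef2))] (every order; ours as bookkeeping) -/
theorem integral_wordSq_rpow_le_high (n : ℕ) {m : ℝ} (hm : 3 < m)
    {v : UnitAddTorus (Fin 3) → EuclideanSpace ℝ (Fin 3)} (hv : IsSmooth v) (hmean : HasZeroMean v)
    {C : ℝ} (hC : ∫ x, (∑ w : Fin n → Fin 3, ‖wordDeriv (List.ofFn w) v x‖ ^ 2) ^ 3 ≤
      C * torusHsEnergy ((n : ℝ) + 1) v ^ 3) :
    ∫ x, (∑ w : Fin n → Fin 3, ‖wordDeriv (List.ofFn w) v x‖ ^ 2) ^ m ≤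
      C * (2 / π ^ 2) ^ (m - 3) * torusHsEnergy ((n : ℝ) + 1) v ^ ((m + 3) / 2) *
        torusHsEnergy ((n : ℝ) + 2) v ^ ((m - 3) / 2) := by
  have hπ : 0 < π := Real.pi_pos
  set G : UnitAddTorus (Fin 3) → ℝ := fun x => ∑ w : Fin n → Fin 3, ‖wordDeriv (List.ofFn w) v x‖ ^ 2 with hG
  set Y : ℝ := torusHsEnergy ((n : ℝ) + 1) v with hY
  set Z : ℝ := torusHsEnergy ((n : ℝ) + 2) v with hZ
  have hn0 : (0 : ℝ) ≤ n := Nat.cast_nonneg n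
  have hY0 : 0 ≤ Y := torusHsEnergy_nonneg (by linarith) hv
  have hZ0 : 0 ≤ Z := torusHsEnergy_nonneg (by linarith) hv
  have hG0 : ∀ x, 0 ≤ G x := fun x => Finset.sum_nonneg fun w _ => sq_nonneg _
  set A : ℝ := 2 / π ^ 2 * Real.sqrt Y * Real.sqrt Z with hA
  have hc0 : (0 : ℝ) ≤ 2 / π ^ 2 := by positivity
  have hA0 : 0 ≤ A := by rw [hA]; positivity
  have hGA : ∀ x, G x ≤ A := fun x => by
    have h := HsWordEnergy.sum_norm_sq_wordDeriv_le_agmon (d := Fin 3) (by simp) n hv hmean x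
    simpa only [hG, hY, hZ, hA] using h
  -- pointwise `G^m ≤ A^{m-3} G^3`
  have hpt : ∀ x, G x ^ m ≤ A ^ (m - 3) * G x ^ 3 := fun x => by
    have e : G x ^ m = G x ^ (m - 3) * G x ^ 3 := by
      rw [show m = (m - 3) + (3 : ℕ) by push_cast; ring, Real.rpow_add_natCast' (hG0 x) (by push_cast; linarith)]
      simp
    rw [e]
    exact mul_le_mul_of_nonneg_right (Real.rpow_le_rpow (hG0 x) (hGA x) (by linarith)) (pow_nonneg (hG0 x) 3)
  have hGc : Continuous G :=
    continuous_finsetSum _ fun w _ => ((isSmooth_wordDeriv hv _).continuous.norm).pow 2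
  have hi1 : Integrable (fun x => G x ^ m) := (hGc.rpow_const fun x => Or.inr (by linarith)).integrable_unitAddTorus
  have hi2 : Integrable (fun x => A ^ (m - 3) * G x ^ 3) := ((hGc.pow 3).const_mul _).integrable_unitAddTorus
  have hI : ∫ x, G x ^ m ≤ A ^ (m - 3) * ∫ x, G x ^ 3 := by
    have := integral_mono hi1 hi2 hpt
    rwa [MeasureTheory.integral_const_mul] at this
  -- `A^{m-3} = (2/π²)^{m-3} Y^{(m-3)/2} Z^{(m-3)/2}`
  have hAm : A ^ (m - 3) = (2 / π ^ 2) ^ (m - 3) * Y ^ ((m - 3) / 2) * Z ^ ((m - 3) / 2) := by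
    rw [hA, Real.mul_rpow (mul_nonneg hc0 (Real.sqrt_nonneg _)) (Real.sqrt_nonneg _),
      Real.mul_rpow hc0 (Real.sqrt_nonneg _), Real.sqrt_eq_rpow, Real.sqrt_eq_rpow,
      ← Real.rpow_mul hY0, ← Real.rpow_mul hZ0]
    congr 2 <;> ring_nf
  have h3 : 0 ≤ ∫ x, G x ^ 3 := integral_nonneg fun x => pow_nonneg (hG0 x) 3
  calc ∫ x, G x ^ m ≤ A ^ (m - 3) * ∫ x, G x ^ 3 := hI
    _ ≤ A ^ (m - 3) * (C * Y ^ 3) := mul_le_mul_of_nonneg_left hC (Real.rpow_nonneg hA0 _)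
    _ = (2 / π ^ 2) ^ (m - 3) * Y ^ ((m - 3) / 2) * Z ^ ((m - 3) / 2) * (C * Y ^ (3 : ℝ)) := by
        rw [hAm]; norm_cast
    _ = C * (2 / π ^ 2) ^ (m - 3) * (Y ^ ((m - 3) / 2) * Y ^ (3 : ℝ)) * Z ^ ((m - 3) / 2) := by ring
    _ = C * (2 / π ^ 2) ^ (m - 3) * Y ^ ((m + 3) / 2) * Z ^ ((m - 3) / 2) := by
        rw [← Real.rpow_add' hY0 (by linarith)]
        congr 2; ring_nf

/-! ## 2. The squares `(n, m)`, `3 < m < ∞` -/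

/-- **Squares `(n, m)`, `3 < m < ∞`, of Gibbon's chessboard on `T³`, every `n ≥ 0`**
(`‖∇ⁿu‖_{2m}^{α_{n,m}} = (∫|∇ⁿu|^{2m})^{1/(2m(n+1)−3)}`): for `ν > 0`, `M ≥ 0` there is `K ≥ 0` with
`∫₀ᵀ (∫ (∑_w ‖∂^w u(t)‖²)^m dx)^{1/(2m(n+1)−3)} dt ≤ K(1+T)` along every classical zero-mean solution of
unforced Navier–Stokes on `[0, T] × T³` with `‖u(0)‖₂² ≤ M` (sup × `L⁶` at order `n`, then Hölder in
time with weights `a = (m+3)(2n+1)/(2(2m(n+1)−3))` on `E_{n+1}^{1/(2n+1)}` and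
`b = (m−3)(2n+3)/(2(2m(n+1)−3))` on `E_{n+2}^{1/(2n+3)}`, `a + b = 1`).
[cite: Gibbon2019Chessboard, Thm 2 (i) (3 < m < ∞), Appendix A §5.1] [cite: FoiasGuillopeTemam1981, Thm 3.1]
(classical solutions, every order; ours) -/
theorem chessboard_high (n : ℕ) {m : ℝ} (hm : 3 < m) {ν M : ℝ} (hν : 0 < ν) (hM : 0 ≤ M) :
    ∃ K : ℝ, 0 ≤ K ∧ ∀ {T : ℝ}, 0 < T →
      ∀ {u : ℝ → UnitAddTorus (Fin 3) → EuclideanSpace ℝ (Fin 3)} {p : ℝ → UnitAddTorus (Fin 3) → ℝ},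
      IsClassicalNSSolutionOn (Icc 0 T) ν 0 u p → (∀ t ∈ Icc 0 T, HasZeroMean (u t)) →
        ∫ x, ‖u 0 x‖ ^ 2 ≤ M →
          ∫ t in (0 : ℝ)..T, (∫ x, (∑ w : Fin n → Fin 3, ‖wordDeriv (List.ofFn w) (u t) x‖ ^ 2) ^ m) ^
              (2 * m * ((n : ℝ) + 1) - 3)⁻¹ ≤ K * (1 + T) := by
  have hπ : 0 < π := Real.pi_pos
  have hn0 : (0 : ℝ) ≤ n := Nat.cast_nonneg n
  obtain ⟨C, hC0, hC⟩ := HsWordEnergy.exists_integral_cube_sum_norm_sq_wordDeriv_le (d := Fin 3) (by simp) n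
  obtain ⟨K₁, hK₁0, hK₁⟩ := HsTimeAverages.timeAverage_le (s := (n : ℝ) + 1) (by linarith) hν hM
  obtain ⟨K₂, hK₂0, hK₂⟩ := HsTimeAverages.timeAverage_le (s := (n : ℝ) + 2) (by linarith) hν hM
  have hD : 0 < 2 * m * ((n : ℝ) + 1) - 3 := by nlinarith
  set e : ℝ := (2 * m * ((n : ℝ) + 1) - 3)⁻¹ with he
  have he0 : 0 < e := by rw [he]; positivity
  set a : ℝ := e * ((m + 3) / 2) * (2 * ((n : ℝ) + 1) - 1) with ha
  set b : ℝ := e * ((m - 3) / 2) * (2 * ((n : ℝ) + 2) - 1) with hb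
  have ha0 : 0 < a := by rw [ha]; exact mul_pos (mul_pos he0 (by linarith)) (by linarith)
  have hb0 : 0 < b := by rw [hb]; exact mul_pos (mul_pos he0 (by linarith)) (by linarith)
  have hab : a + b = 1 := by
    rw [ha, hb, he]; field_simp; ring
  set c₀ : ℝ := C * (2 / π ^ 2) ^ (m - 3) with hc₀
  have hc₀0 : 0 ≤ c₀ := by rw [hc₀]; positivity
  refine ⟨c₀ ^ e * (K₁ ^ a * K₂ ^ b),
    mul_nonneg (Real.rpow_nonneg hc₀0 _) (mul_nonneg (Real.rpow_nonneg hK₁0 _) (Real.rpow_nonneg hK₂0 _)),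
    fun {T} hT u p h hmean hu0 => ?_⟩
  set G : ℝ → UnitAddTorus (Fin 3) → ℝ :=
    fun t x => ∑ w : Fin n → Fin 3, ‖wordDeriv (List.ofFn w) (u t) x‖ ^ 2 with hG
  set Y : ℝ → ℝ := fun t => torusHsEnergy ((n : ℝ) + 1) (u t) with hY
  set Z : ℝ → ℝ := fun t => torusHsEnergy ((n : ℝ) + 2) (u t) with hZ
  have hY0 : ∀ t ∈ Icc 0 T, 0 ≤ Y t := fun t ht =>
    torusHsEnergy_nonneg (by linarith) (h.smooth_velocity.isSmooth_slice ht)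
  have hZ0 : ∀ t ∈ Icc 0 T, 0 ≤ Z t := fun t ht =>
    torusHsEnergy_nonneg (by linarith) (h.smooth_velocity.isSmooth_slice ht)
  have hGm0 : ∀ t, 0 ≤ ∫ x, G t x ^ m := fun t =>
    integral_nonneg fun x => Real.rpow_nonneg (Finset.sum_nonneg fun w _ => sq_nonneg _) _
  set F₁ : ℝ → ℝ := fun t => Y t ^ (2 * ((n : ℝ) + 1) - 1)⁻¹ with hF₁
  set F₂ : ℝ → ℝ := fun t => Z t ^ (2 * ((n : ℝ) + 2) - 1)⁻¹ with hF₂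
  have hF₁0 : ∀ t ∈ Icc 0 T, 0 ≤ F₁ t := fun t ht => Real.rpow_nonneg (hY0 t ht) _
  have hF₂0 : ∀ t ∈ Icc 0 T, 0 ≤ F₂ t := fun t ht => Real.rpow_nonneg (hZ0 t ht) _
  have hn2 : (2 * ((n : ℝ) + 1) - 1) ≠ 0 := by
    have : (0 : ℝ) < 2 * ((n : ℝ) + 1) - 1 := by linarith
    exact this.ne'
  have hn3 : (2 * ((n : ℝ) + 2) - 1) ≠ 0 := by
    have : (0 : ℝ) < 2 * ((n : ℝ) + 2) - 1 := by linarith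
    exact this.ne'
  -- pointwise in time
  have hpt : ∀ t ∈ Icc 0 T, (∫ x, G t x ^ m) ^ e ≤ c₀ ^ e * (F₁ t ^ a * F₂ t ^ b) := by
    intro t ht
    have hut : IsSmooth (u t) := h.smooth_velocity.isSmooth_slice ht
    have h1 := integral_wordSq_rpow_le_high n hm hut (hmean t ht) (hC (u t) hut (hmean t ht))
    have h2 : (∫ x, G t x ^ m) ^ e ≤ (c₀ * Y t ^ ((m + 3) / 2) * Z t ^ ((m - 3) / 2)) ^ e := by
      refine Real.rpow_le_rpow (hGm0 t) ?_ he0.le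
      rw [hc₀]; exact h1
    refine h2.trans_eq ?_
    rw [Real.mul_rpow (mul_nonneg hc₀0 (Real.rpow_nonneg (hY0 t ht) _)) (Real.rpow_nonneg (hZ0 t ht) _),
      Real.mul_rpow hc₀0 (Real.rpow_nonneg (hY0 t ht) _), ← Real.rpow_mul (hY0 t ht),
      ← Real.rpow_mul (hZ0 t ht), hF₁, hF₂]
    simp only
    rw [← Real.rpow_mul (hY0 t ht), ← Real.rpow_mul (hZ0 t ht)]
    have e1 : (m + 3) / 2 * e = (2 * ((n : ℝ) + 1) - 1)⁻¹ * a := by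
      rw [ha, show (2 * ((n : ℝ) + 1) - 1)⁻¹ * (e * ((m + 3) / 2) * (2 * ((n : ℝ) + 1) - 1)) =
        e * ((m + 3) / 2) * ((2 * ((n : ℝ) + 1) - 1)⁻¹ * (2 * ((n : ℝ) + 1) - 1)) by ring, inv_mul_cancel₀ hn2]
      ring
    have e2 : (m - 3) / 2 * e = (2 * ((n : ℝ) + 2) - 1)⁻¹ * b := by
      rw [hb, show (2 * ((n : ℝ) + 2) - 1)⁻¹ * (e * ((m - 3) / 2) * (2 * ((n : ℝ) + 2) - 1)) =
        e * ((m - 3) / 2) * ((2 * ((n : ℝ) + 2) - 1)⁻¹ * (2 * ((n : ℝ) + 2) - 1)) by ring, inv_mul_cancel₀ hn3]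
      ring
    rw [e1, e2]
    ring
  -- continuity
  have hIc : ContinuousOn (fun t => (∫ x, G t x ^ m) ^ e) (Icc 0 T) :=
    (continuousOn_integral_wordSq_rpow hT h n (by linarith : (0 : ℝ) ≤ m)).rpow_const
      fun t _ => Or.inr he0.le
  have hF₁c : ContinuousOn F₁ (Icc 0 T) :=
    (HsTimeAverages.continuousOn_hsEnergy (by linarith) hT h).rpow_const
      fun t _ => Or.inr (inv_nonneg.2 (by linarith))
  have hF₂c : ContinuousOn F₂ (Icc 0 T) :=
    (HsTimeAverages.continuousOn_hsEnergy (by linarith) hT h).rpow_const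
      fun t _ => Or.inr (inv_nonneg.2 (by linarith))
  have hRc : ContinuousOn (fun t => c₀ ^ e * (F₁ t ^ a * F₂ t ^ b)) (Icc 0 T) :=
    continuousOn_const.mul ((hF₁c.rpow_const fun t _ => Or.inr ha0.le).mul
      (hF₂c.rpow_const fun t _ => Or.inr hb0.le))
  have hmono : ∫ t in (0 : ℝ)..T, (∫ x, G t x ^ m) ^ e ≤
      ∫ t in (0 : ℝ)..T, c₀ ^ e * (F₁ t ^ a * F₂ t ^ b) :=
    intervalIntegral.integral_mono_on hT.le (hIc.mono (by rw [uIcc_of_le hT.le])).intervalIntegrable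
      (hRc.mono (by rw [uIcc_of_le hT.le])).intervalIntegrable fun t ht => hpt t ht
  rw [intervalIntegral.integral_const_mul] at hmono
  have hH := time_holder hT ha0 hb0 hab hF₁c hF₂c hF₁0 hF₂0 hK₁0 hK₂0 (hK₁ hT h hmean hu0)
    (hK₂ hT h hmean hu0)
  calc ∫ t in (0 : ℝ)..T, (∫ x, G t x ^ m) ^ e
      ≤ c₀ ^ e * ∫ t in (0 : ℝ)..T, F₁ t ^ a * F₂ t ^ b := hmono
    _ ≤ c₀ ^ e * (K₁ ^ a * K₂ ^ b * (1 + T)) := mul_le_mul_of_nonneg_left hH (Real.rpow_nonneg hc₀0 _)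
    _ = c₀ ^ e * (K₁ ^ a * K₂ ^ b) * (1 + T) := by ring

/-! ## 3. The row `m = ∞` in majorant form -/

/-- The explicit Agmon majorant of `|∇ⁿu(t)|²` along a classical zero-mean solution:
`∑_w ‖∂^w u(t,x)‖² ≤ (2/π²) √E_{n+1}(u(t)) √E_{n+2}(u(t))` for all `t ∈ [0, T]`, `x ∈ T³`.
[cite: Ayala2014Thesis, App. A (A.3)] (every order; ours as bookkeeping) -/
theorem wordSq_le_agmonMajorant (n : ℕ) {ν T : ℝ}
    {u : ℝ → UnitAddTorus (Fin 3) → EuclideanSpace ℝ (Fin 3)} {p : ℝ → UnitAddTorus (Fin 3) → ℝ}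
    (h : IsClassicalNSSolutionOn (Icc 0 T) ν 0 u p) (hmean : ∀ t ∈ Icc 0 T, HasZeroMean (u t))
    {t : ℝ} (ht : t ∈ Icc 0 T) (x : UnitAddTorus (Fin 3)) :
    ∑ w : Fin n → Fin 3, ‖wordDeriv (List.ofFn w) (u t) x‖ ^ 2 ≤
      2 / π ^ 2 * Real.sqrt (torusHsEnergy ((n : ℝ) + 1) (u t)) *
        Real.sqrt (torusHsEnergy ((n : ℝ) + 2) (u t)) :=
  HsWordEnergy.sum_norm_sq_wordDeriv_le_agmon (d := Fin 3) (by simp) n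
    (h.smooth_velocity.isSmooth_slice ht) (hmean t ht) x

/-- **Row `m = ∞` of Gibbon's chessboard on `T³`, every `n ≥ 0`, majorant form** (`α_{n,∞} = 1/(n+1)`,
`‖∇ⁿu‖_∞^{α_{n,∞}} = (sup_x |∇ⁿu|²)^{1/(2(n+1))}`): for `ν > 0`, `M ≥ 0` there is `K ≥ 0` such that
along every classical zero-mean solution of unforced Navier–Stokes on `[0, T] × T³` with
`‖u(0)‖₂² ≤ M`, the Agmon majorant `A_n(t) = (2/π²)√E_{n+1}(u(t))√E_{n+2}(u(t)) ≥ |∇ⁿu(t,x)|²`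
(`wordSq_le_agmonMajorant`) satisfies `∫₀ᵀ A_n(t)^{1/(2(n+1))} dt ≤ K(1+T)` (Hölder in time with
weights `(2n+1)/(4(n+1))` on `E_{n+1}^{1/(2n+1)}` and `(2n+3)/(4(n+1))` on `E_{n+2}^{1/(2n+3)}` against
FGT). `n = 0, 1` are the tree's `Torus.classicalNS_integral_agmonMajorant_le` /
`…gradientAgmonMajorant_le` up to constants. [cite: Gibbon2019Chessboard, Thm 2 (i)–(ii) eq. (w1)
(row m = ∞); cf. Thm 1 / Table 1 (inverse-length-scale form)]
[cite: FoiasGuillopeTemam1981, Thm 3.1] (classical solutions, every order; ours) -/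
theorem chessboard_top (n : ℕ) {ν M : ℝ} (hν : 0 < ν) (hM : 0 ≤ M) :
    ∃ K : ℝ, 0 ≤ K ∧ ∀ {T : ℝ}, 0 < T →
      ∀ {u : ℝ → UnitAddTorus (Fin 3) → EuclideanSpace ℝ (Fin 3)} {p : ℝ → UnitAddTorus (Fin 3) → ℝ},
      IsClassicalNSSolutionOn (Icc 0 T) ν 0 u p → (∀ t ∈ Icc 0 T, HasZeroMean (u t)) →
        ∫ x, ‖u 0 x‖ ^ 2 ≤ M →
          ∫ t in (0 : ℝ)..T, (2 / π ^ 2 * Real.sqrt (torusHsEnergy ((n : ℝ) + 1) (u t)) *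
              Real.sqrt (torusHsEnergy ((n : ℝ) + 2) (u t))) ^ (2 * ((n : ℝ) + 1))⁻¹ ≤ K * (1 + T) := by
  have hπ : 0 < π := Real.pi_pos
  have hn0 : (0 : ℝ) ≤ n := Nat.cast_nonneg n
  obtain ⟨K₁, hK₁0, hK₁⟩ := HsTimeAverages.timeAverage_le (s := (n : ℝ) + 1) (by linarith) hν hM
  obtain ⟨K₂, hK₂0, hK₂⟩ := HsTimeAverages.timeAverage_le (s := (n : ℝ) + 2) (by linarith) hν hM
  have hN : 0 < 2 * ((n : ℝ) + 1) := by positivity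
  set e : ℝ := (2 * ((n : ℝ) + 1))⁻¹ with he
  have he0 : 0 < e := by rw [he]; positivity
  set a : ℝ := e * (1 / 2) * (2 * ((n : ℝ) + 1) - 1) with ha
  set b : ℝ := e * (1 / 2) * (2 * ((n : ℝ) + 2) - 1) with hb
  have ha0 : 0 < a := by rw [ha]; exact mul_pos (mul_pos he0 (by norm_num)) (by linarith)
  have hb0 : 0 < b := by rw [hb]; exact mul_pos (mul_pos he0 (by norm_num)) (by linarith)
  have hab : a + b = 1 := by
    rw [ha, hb, he]; field_simp; ring
  have hc0 : (0 : ℝ) ≤ 2 / π ^ 2 := by positivity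
  refine ⟨(2 / π ^ 2) ^ e * (K₁ ^ a * K₂ ^ b),
    mul_nonneg (Real.rpow_nonneg hc0 _) (mul_nonneg (Real.rpow_nonneg hK₁0 _) (Real.rpow_nonneg hK₂0 _)),
    fun {T} hT u p h hmean hu0 => ?_⟩
  set Y : ℝ → ℝ := fun t => torusHsEnergy ((n : ℝ) + 1) (u t) with hY
  set Z : ℝ → ℝ := fun t => torusHsEnergy ((n : ℝ) + 2) (u t) with hZ
  have hY0 : ∀ t ∈ Icc 0 T, 0 ≤ Y t := fun t ht =>
    torusHsEnergy_nonneg (by linarith) (h.smooth_velocity.isSmooth_slice ht)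
  have hZ0 : ∀ t ∈ Icc 0 T, 0 ≤ Z t := fun t ht =>
    torusHsEnergy_nonneg (by linarith) (h.smooth_velocity.isSmooth_slice ht)
  set F₁ : ℝ → ℝ := fun t => Y t ^ (2 * ((n : ℝ) + 1) - 1)⁻¹ with hF₁
  set F₂ : ℝ → ℝ := fun t => Z t ^ (2 * ((n : ℝ) + 2) - 1)⁻¹ with hF₂
  have hF₁0 : ∀ t ∈ Icc 0 T, 0 ≤ F₁ t := fun t ht => Real.rpow_nonneg (hY0 t ht) _
  have hF₂0 : ∀ t ∈ Icc 0 T, 0 ≤ F₂ t := fun t ht => Real.rpow_nonneg (hZ0 t ht) _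
  have hn2 : (2 * ((n : ℝ) + 1) - 1) ≠ 0 := by
    have : (0 : ℝ) < 2 * ((n : ℝ) + 1) - 1 := by linarith
    exact this.ne'
  have hn3 : (2 * ((n : ℝ) + 2) - 1) ≠ 0 := by
    have : (0 : ℝ) < 2 * ((n : ℝ) + 2) - 1 := by linarith
    exact this.ne'
  -- pointwise in time: `A^e = (2/π²)^e F₁^a F₂^b`
  have hpt : ∀ t ∈ Icc 0 T, (2 / π ^ 2 * Real.sqrt (Y t) * Real.sqrt (Z t)) ^ e =
      (2 / π ^ 2) ^ e * (F₁ t ^ a * F₂ t ^ b) := by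
    intro t ht
    rw [Real.mul_rpow (mul_nonneg hc0 (Real.sqrt_nonneg _)) (Real.sqrt_nonneg _),
      Real.mul_rpow hc0 (Real.sqrt_nonneg _), Real.sqrt_eq_rpow, Real.sqrt_eq_rpow,
      ← Real.rpow_mul (hY0 t ht), ← Real.rpow_mul (hZ0 t ht), hF₁, hF₂]
    simp only
    rw [← Real.rpow_mul (hY0 t ht), ← Real.rpow_mul (hZ0 t ht)]
    have e1 : 1 / 2 * e = (2 * ((n : ℝ) + 1) - 1)⁻¹ * a := by
      rw [ha, show (2 * ((n : ℝ) + 1) - 1)⁻¹ * (e * (1 / 2) * (2 * ((n : ℝ) + 1) - 1)) =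
        e * (1 / 2) * ((2 * ((n : ℝ) + 1) - 1)⁻¹ * (2 * ((n : ℝ) + 1) - 1)) by ring, inv_mul_cancel₀ hn2]
      ring
    have e2 : 1 / 2 * e = (2 * ((n : ℝ) + 2) - 1)⁻¹ * b := by
      rw [hb, show (2 * ((n : ℝ) + 2) - 1)⁻¹ * (e * (1 / 2) * (2 * ((n : ℝ) + 2) - 1)) =
        e * (1 / 2) * ((2 * ((n : ℝ) + 2) - 1)⁻¹ * (2 * ((n : ℝ) + 2) - 1)) by ring, inv_mul_cancel₀ hn3]
      ring
    rw [show (2 * ((n : ℝ) + 1) - 1)⁻¹ * a = 1 / 2 * e from e1.symm,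
      show (2 * ((n : ℝ) + 2) - 1)⁻¹ * b = 1 / 2 * e from e2.symm]
    ring
  -- continuity
  have hF₁c : ContinuousOn F₁ (Icc 0 T) :=
    (HsTimeAverages.continuousOn_hsEnergy (by linarith) hT h).rpow_const
      fun t _ => Or.inr (inv_nonneg.2 (by linarith))
  have hF₂c : ContinuousOn F₂ (Icc 0 T) :=
    (HsTimeAverages.continuousOn_hsEnergy (by linarith) hT h).rpow_const
      fun t _ => Or.inr (inv_nonneg.2 (by linarith))
  have hL : ∫ t in (0 : ℝ)..T, (2 / π ^ 2 * Real.sqrt (Y t) * Real.sqrt (Z t)) ^ e =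
      ∫ t in (0 : ℝ)..T, (2 / π ^ 2) ^ e * (F₁ t ^ a * F₂ t ^ b) :=
    intervalIntegral.integral_congr fun t ht => hpt t (by rwa [uIcc_of_le hT.le] at ht)
  rw [hL, intervalIntegral.integral_const_mul]
  have hH := time_holder hT ha0 hb0 hab hF₁c hF₂c hF₁0 hF₂0 hK₁0 hK₂0 (hK₁ hT h hmean hu0)
    (hK₂ hT h hmean hu0)
  calc (2 / π ^ 2) ^ e * ∫ t in (0 : ℝ)..T, F₁ t ^ a * F₂ t ^ b
      ≤ (2 / π ^ 2) ^ e * (K₁ ^ a * K₂ ^ b * (1 + T)) := mul_le_mul_of_nonneg_left hH (Real.rpow_nonneg hc0 _)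
    _ = (2 / π ^ 2) ^ e * (K₁ ^ a * K₂ ^ b) * (1 + T) := by ring

end HsChessboard

end Summit.NavierStokesRegularity.FunctionalMining
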